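import Summits.AtomisticToContinuum.BoseEinsteinCondensation.Theorems.BECStronglyRayleighLatticeToPeriodicBridgeMuffinTinLatticeReadout
import Summits.AtomisticToContinuum.BoseEinsteinCondensation.Theorems.BECStronglyRayleighLatticeToPeriodicBridgeMuffinTinFreeEndRigidity
import Summits.AtomisticToContinuum.BoseEinsteinCondensation.Theorems.BECStronglyRayleighLatticeToPeriodicBridgeMuffinTinMaxwellDanskin
import Summits.AtomisticToContinuum.BoseEinsteinCondensation.Theorems.BECStronglyRayleighLatticeToPeriodicBridgeMuffinTinDeepWellLimit
import Summits.AtomisticToContinuum.BoseEinsteinCondensation.Theorems.BECStronglyRayleighSectorGroundStatePerron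
import Summits.AtomisticToContinuum.BoseEinsteinCondensation.Theorems.BECStronglyRayleighPenaltySelectsSector

/-!
# Line `muffin-tin-reward-supermodularity` — skeleton v4 (lead prover-line-stmt-AtomisticToContinuum-9674-c2-0; = lead-1's v3, stubs unchanged) for the crux
# `BECStronglyRayleigh.LatticeToPeriodicBridge` (crux item stmt-AtomisticToContinuum-9674, rank 4,
# route `route-AtomisticToContinuum-BECStronglyRayleigh`)

Crux (FIXED, by name): `LatticeToPeriodicBridge := KineticLatticeBEC → PeriodicBEC` — uniform RP-free BEC of hard-core
lattice bosons on the even tori `(ℤ/Mℤ)³` at every filling `≤ ½` (the antecedent `A`) implies torus BEC of the dilute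
continuum gas (`∀ v` repulsive finite-range `∃ρ₀ ∀ρ<ρ₀ ∃c>0 ∀ᶠN ∃δ>0`, every periodic `δ`-near-minimiser on the torus of
side `L_N = (N/ρ)^{1/3}` has constant-mode occupation `≥ cN`).

Idea, objects and stub STATEMENTS: see the planner's skeleton v1 (`Lines/muffin-tin-reward-supermodularity.lean` @ 677e2a5,
card `Lines/muffin-tin-reward-supermodularity.md`) and the landed Defs module
`Theorems/BECStronglyRayleighLatticeToPeriodicBridgeMuffinTinDefs.lean` (this file imports it; every object and every stub
statement lives there verbatim so that stub files prove `Sig.stub_<name>` BY NAME).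

LEAD'S RESHAPE (v2 → v3, 2026-08-16; v3 = after wave 1: S3, S4, S1b LANDED, S2 reshaped to its minimal analytic fact):
* S4 `stub_freeEndRigidity : Sig.stub_freeEndRigidity := PeriodicRigidity → FreeEndRigidity` — the fixed-`N` route item
  `BECLiebAntibunching.PeriodicRigidity` (stmt-AtomisticToContinuum-9467, weakest typed form `∀η ∀ᶠN ∃δ`) is taken BY NAME
  (as line coarse-cell-lorentzian's S6 did); the composition therefore carries `hR : PeriodicRigidity` as a third named
  hypothesis next to `SectorGroundStatePerron` (9677, proved) and `PenaltySelectsSector` (9678, proved).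
* S1 `WallsOnlyDeplete` (LDM₀ for `n₀⁺`, all `λ ≥ 0`) is WEAKENED AND SPLIT: the composition only needs
  `liminf_λ n₀⁺(λ,0) ≤ n₀⁺(0,0)`, so the registered open stub is `stub_deepWallGerm : Sig.stub_deepWallGerm := DeepWallGerm`
  (the `κ = 0⁺` supermodularity germ of `E(λ,κ)` at `λ₁ = 0`, EVENTUALLY in `λ` — strictly weaker than the planner's tool
  `RewardWallGerm`, and free of the small-`λ` regime; HARDEST) plus `stub_maxwellDanskin : Sig.stub_maxwellDanskin :=
  MaxwellDanskin` (Danskin ⇒ Maxwell, provable now), re-glued to `DeepWallsDeplete` (`∀ᶠ λ, n₀⁺(λ,0) ≤ n₀⁺(0,0)`) by the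
  proved `deepWallsDeplete_of_germ` (Defs, appended p96476).
* WAVE 1 (v3): `stub_latticeReadout` LANDED p97179 (`…MuffinTinLatticeReadout.lean`), `stub_freeEndRigidity` LANDED p96883
  (`…MuffinTinFreeEndRigidity.lean`), `stub_maxwellDanskin` LANDED p97324 (`…MuffinTinMaxwellDanskin.lean`) — imported here
  under their registered names; `stub_deepWallBand` audited (true as stated, no junk corner) and RESHAPED to the minimal
  analytic fact it is conditional on, `stub_deepWellCondensateLimit : Sig.stub_deepWellCondensateLimit := DeepWellCondensateLimit`
  (module `…MuffinTinDeepWellLimit.lean`, glue `deepWallBand_of_deepWellCondensateLimit` PROVED there).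
* Registered stubs of v3 (2, both open): `stub_deepWallGerm` (S1a, the comparison SIGN, XL/open, lead) and
  `stub_deepWellCondensateLimit` (S2', the `N`-boson `M³`-well tight-binding limit, XL: not in print beyond one body / two
  wells, no Schrödinger spectral theory in Mathlib).
* `LatticeToPeriodicBridge_of` — the planner's kernel-checked composition, now with hypotheses = the 2 open stubs + the
  route item `PeriodicRigidity` (9467) by name; `SectorGroundStatePerron` (9677) and `PenaltySelectsSector` (9678) are
  discharged by their landed proofs (`Theorems.SectorGroundStatePerron_proof`, `Theorems.PenaltySelectsSector_proof`).

LEAD c2-0 (2026-08-16T14:00Z, lineage-0 continuation after `coarse-cell-lorentzian` was filed DEAD — certified dictionary,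
`Lines/coarse-cell-lorentzian-dead.md`): v4 = v3 re-registered by this seat, SAME two open stubs `stub_deepWallGerm` (S1a, lead)
and `stub_deepWellCondensateLimit` (S2′, worker); composition `LatticeToPeriodicBridge_of` byte-identical. This cycle's attack on
S1a is two-sided: DOWN sandwich in Lean (confinement bound `n₀ ≤ (1+η)(1−w)³N + (1+η⁻¹)⟨W⟩`, so `n₀⁺(λ,0) ≤ ((1−w)³+ε)N`
eventually in `λ` wherever some finite-energy state lives in the wells, hence S1a at every geometry where `n₀⁺(0,0) > (1−w)³N`)
and a corner audit of S1a/S2′ against the v3 signatures (Disproof.lean predates them).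

Disproof.lean (gen 2 FINAL, 05:53Z; re-read 10:30Z) honoured as in v1: no `_false_without_` theorem exists (RESISTS); §4/§7
Negative lemmas refute windowed / `v`-uniform bridges — no stub has that shape (`δ` is S4's rigidity window, `ρ₀` depends
on `v`); §8c LDM₀ scan: 0/101 violations; `-- Targets`: none posted against muffin-tin stubs yet.
-/

noncomputable section

namespace Summit.AtomisticToContinuum.BoseEinsteinCondensation.Cruxes.LatticeToPeriodicBridge.MuffinTinRewardSupermodularity

open MeasureTheory Filter
open scoped ENNReal NNReal BigOperators Topology
open Literature.MathematicalPhysics.QuantumManyBody.BoseGas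
open Literature.MathematicalPhysics.QuantumLattice
open Literature.Probability.LatticeModels (TorusSite)
open Summit.AtomisticToContinuum.BoseEinsteinCondensation.Theses
open Summit.AtomisticToContinuum.BoseEinsteinCondensation.Theses.BECStronglyRayleigh

/-! ## Registered stubs (statements `Sig.stub_*` in the Defs module) -/

/-- **S1a `stub_deepWallGerm`** (HARDEST; the line's bet — the open comparison SIGN in its energy form: the `κ = 0⁺`
germ of supermodularity of the two-coupling energy `E(λ,κ)` on `{0, λ} × [0, κ₀]`, EVENTUALLY in the wall height `λ`
(the lead's weakening of the planner's `RewardWallGerm`/`WallsOnlyDeplete`: only the deep regime is consumed), thick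
walls, low density). Why plausibly true: `N = 1` / `v = 0` one-body monotonicity (0 violations in 80 continuum geometries,
triage r1-1/r1-3); interacting ED caricatures (ideator j008682: 1953/1953 supermodularity minors `> 0`; triage r1-3: 0/56;
Disproof §8c: 0/101); LDA: a density modulation only adds depletion (convexity of `ρ^{3/2}`) and only costs constant-mode
share; and in the deep regime the structural slack `z_w ≪ 1`. Honest difficulty: a comparison of two many-body ground
states in the regime `L ≫ ξ`; no correlation-inequality tool in print. Size XL (open). -/
theorem stub_deepWallGerm : Sig.stub_deepWallGerm := by
  sorry

/-- **S2' `stub_deepWellCondensateLimit`** (the deep-well condensate limit: for fixed `(v, R₀, w, M, L, N)` with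
`2R₀ < wL/M`, `R₀ < (1−w)L/M` and a normalised sector ground vector `ψ` of the hopping model, `∀ ε > 0 ∀ᶠ λ ∀ δ > 0` some
`δ`-near-minimiser `Ψ` of `E_v + λ⟨W⟩` has `n₀(Ψ) ≥ z_w·cohSum(ψ)/M³ − ε`; wave-1 audit: the planner's `DeepWallBand`
follows from it in 45 lines (`deepWallBand_of_deepWellCondensateLimit`) and has no false corner). Why plausibly true:
separable square-barrier Kronig–Penney one-body band + finite-rank Feshbach–Schur at fixed `(N, M)` with the in-well pair
cost fixed against `t_λ → 0` (planner card; audit §(c)). Size XL (Mathlib has no Schrödinger spectral theory; the `N`-body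
reduction is not in print beyond two wells). -/
theorem stub_deepWellCondensateLimit : Sig.stub_deepWellCondensateLimit := by
  sorry

/-! ## Proved glue -/

section Glue

/-- Unfolding `n₀⁺(0,0)` at ONE window: if `a < n₀⁺(0,0)` then for every `δ > 0` some `δ`-near-minimiser of the
periodic energy has constant-mode occupation `> a`. [folklore] -/
theorem exists_nearMin_of_lt_upperCondensate {v : ℝ → ℝ≥0∞} {N : ℕ} {L : ℝ} {M : ℕ} {w : ℝ} {a : ℝ≥0∞}
    (ha : a < upperCondensate v N L M w 0 0) {δ : ℝ≥0∞} (hδ : 0 < δ) :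
    ∃ Φ : PeriodicTrialState N L, periodicEnergy v Φ ≤ periodicGroundStateEnergy v N L + δ ∧
      a < condensateOccupation N L Φ.ψ := by
  have h1 : a < ⨆ (Ψ : PeriodicTrialState N L)
      (_ : twoCouplingFunctional v M w 0 0 Ψ ≤ twoCouplingEnergy v N L M w 0 0 + δ),
      condensateOccupation N L Ψ.ψ :=
    lt_of_lt_of_le ha (iInf₂_le δ hδ)
  rw [lt_iSup_iff] at h1
  obtain ⟨Φ, hΦ⟩ := h1
  rw [lt_iSup_iff] at hΦ
  obtain ⟨hnear, hlt⟩ := hΦ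
  refine ⟨Φ, ?_, hlt⟩
  rwa [twoCouplingFunctional_zero_zero, twoCouplingEnergy_zero_zero] at hnear

/-- `L_N³ = N/ρ`. [folklore] -/
theorem sideLength_cube {ρ : ℝ} (hρ : 0 < ρ) (N : ℕ) : sideLength ρ N ^ 3 = N / ρ := by
  have h : (0 : ℝ) ≤ N / ρ := div_nonneg N.cast_nonneg hρ.le
  rw [sideLength, show (1 / 3 : ℝ) = ((3 : ℕ) : ℝ)⁻¹ by norm_num, Real.rpow_inv_natCast_pow h three_ne_zero]

/-- `L_N → ∞`. [folklore] -/
theorem sideLength_tendsto {ρ : ℝ} (hρ : 0 < ρ) : Tendsto (fun n : ℕ => sideLength ρ n) atTop atTop :=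
  (tendsto_rpow_atTop (by norm_num : (0 : ℝ) < 1 / 3)).comp
    (tendsto_natCast_atTop_atTop.atTop_div_const hρ)

/-- **Lattice-size selection.** For a wall-period floor `B > 0`, a lattice threshold `L₀` and a density
`ρ ≤ 1/(16B³)`, once `L = L_N` is large the even integer `M = 2⌊L/(2B)⌋₊` satisfies `2 ≤ M`, `L₀ ≤ M`, `B·M ≤ L`
(period `b = L/M ≥ B`) and `2N ≤ M³` (filling `≤ ½`; indeed `≤ 1/16`). [folklore] -/
theorem latticeSize_select {B ρ : ℝ} (hB : 0 < B) (hρ : 0 < ρ) (hρB : ρ ≤ 1 / (16 * B ^ 3)) (L₀ N : ℕ)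
    (hL : max (4 * B) (B * (L₀ + 4)) ≤ sideLength ρ N) :
    Even (2 * ⌊sideLength ρ N / (2 * B)⌋₊) ∧ 2 ≤ 2 * ⌊sideLength ρ N / (2 * B)⌋₊ ∧
      L₀ ≤ 2 * ⌊sideLength ρ N / (2 * B)⌋₊ ∧
      B * ((2 * ⌊sideLength ρ N / (2 * B)⌋₊ : ℕ) : ℝ) ≤ sideLength ρ N ∧
      2 * N ≤ (2 * ⌊sideLength ρ N / (2 * B)⌋₊) ^ 3 := by
  set L := sideLength ρ N with hLdef
  set k : ℕ := ⌊L / (2 * B)⌋₊ with hkdef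
  have hL4 : 4 * B ≤ L := (le_max_left _ _).trans hL
  have hLL₀ : B * (L₀ + 4) ≤ L := (le_max_right _ _).trans hL
  have hLpos : 0 < L := lt_of_lt_of_le (by positivity) hL4
  have hy : 0 ≤ L / (2 * B) := by positivity
  have hkle : (k : ℝ) ≤ L / (2 * B) := Nat.floor_le hy
  have hklt : L / (2 * B) < k + 1 := Nat.lt_floor_add_one _
  have hcast : ((2 * k : ℕ) : ℝ) = 2 * (k : ℝ) := by push_cast; ring
  have hhalfB : 2 * (L / (2 * B)) = L / B := by field_simp
  -- M as a real number, squeezed between L/B - 2 and L/B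
  have hMle : ((2 * k : ℕ) : ℝ) ≤ L / B := by
    rw [hcast, ← hhalfB]; linarith
  have hMge : L / B - 2 < ((2 * k : ℕ) : ℝ) := by
    rw [hcast, ← hhalfB]; linarith
  have hLB4 : 4 ≤ L / B := by rw [le_div_iff₀ hB]; linarith
  have hLBL₀ : (L₀ : ℝ) + 4 ≤ L / B := by rw [le_div_iff₀ hB]; linarith
  refine ⟨even_two_mul k, ?_, ?_, ?_, ?_⟩
  · have h2 : (2 : ℝ) ≤ ((2 * k : ℕ) : ℝ) := by linarith
    exact_mod_cast h2
  · have h2 : (L₀ : ℝ) ≤ ((2 * k : ℕ) : ℝ) := by linarith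
    exact_mod_cast h2
  · calc B * ((2 * k : ℕ) : ℝ) ≤ B * (L / B) := mul_le_mul_of_nonneg_left hMle hB.le
      _ = L := by field_simp
  · -- 2N ≤ M³: M ≥ L/B - 2 ≥ L/(2B), so M³ ≥ L³/(8B³) = N/(8ρB³) ≥ 2N
    have hMhalf : L / (2 * B) ≤ ((2 * k : ℕ) : ℝ) := by
      have h1 : L / (2 * B) ≤ L / B - 2 := by
        rw [← hhalfB]; linarith
      linarith
    have hcube : (L / (2 * B)) ^ 3 ≤ ((2 * k : ℕ) : ℝ) ^ 3 := pow_le_pow_left₀ hy hMhalf 3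
    have hL3 : L ^ 3 = N / ρ := sideLength_cube hρ N
    have h16 : ρ * (16 * B ^ 3) ≤ 1 := by
      rwa [le_div_iff₀ (by positivity : (0 : ℝ) < 16 * B ^ 3)] at hρB
    have hkey : (2 * N : ℝ) ≤ (L / (2 * B)) ^ 3 := by
      rw [div_pow, hL3, le_div_iff₀ (by positivity : (0 : ℝ) < (2 * B) ^ 3)]
      have hrew : (2 * N : ℝ) * (2 * B) ^ 3 = N / ρ * (ρ * (16 * B ^ 3)) := by
        field_simp
        ring
      rw [hrew]
      calc (N : ℝ) / ρ * (ρ * (16 * B ^ 3)) ≤ N / ρ * 1 :=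
            mul_le_mul_of_nonneg_left h16 (by positivity)
        _ = N / ρ := mul_one _
    have h2 : (2 * N : ℝ) ≤ ((2 * k : ℕ) : ℝ) ^ 3 := hkey.trans hcube
    exact_mod_cast h2

/-- `ofReal` bookkeeping of the last step: `a/2 < nΦ ≤ nΨ + a/4` gives `a/8 ≤ nΨ` (for `a ≥ 0`). [folklore] -/
theorem eighth_le_of_half_lt {a : ℝ} (ha : 0 ≤ a) {nΦ nΨ : ℝ≥0∞}
    (h1 : ENNReal.ofReal (a / 2) < nΦ) (h2 : nΦ ≤ nΨ + ENNReal.ofReal (a / 4)) :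
    ENNReal.ofReal (a / 8) ≤ nΨ := by
  have h : ENNReal.ofReal (a / 2) ≤ nΨ + ENNReal.ofReal (a / 4) := h1.le.trans h2
  have hsplit : ENNReal.ofReal (a / 2) = ENNReal.ofReal (a / 4) + ENNReal.ofReal (a / 4) := by
    rw [← ENNReal.ofReal_add (by positivity) (by positivity)]; congr 1; ring
  rw [hsplit] at h
  have h' : ENNReal.ofReal (a / 4) ≤ nΨ := (ENNReal.add_le_add_iff_right ENNReal.ofReal_ne_top).1 h
  exact (ENNReal.ofReal_le_ofReal (by linarith)).trans h'

end Glue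

/-! ## The composition: the two open stubs + the three landed ones (+ route item 9467 by name; 9677/9678 discharged) give the crux BY NAME -/

/-- **`LatticeToPeriodicBridge` from the line `muffin-tin-reward-supermodularity`** (kernel-checked, no `sorry` of
its own; v3: S1 = deep germ + landed Danskin via `deepWallsDeplete_of_germ`, S2 = landed glue applied to S2', S3/S4 landed, S4 applied to `PeriodicRigidity`, 9677/9678 by their landed proofs). Fix `w = ½` (`z = z_{1/2} = (4/π²)³`). Given the antecedent `A` (constants `c, L₀`) and an admissible `v`:
thresholds `b₁, ρ₁` (S1), `b₀` (S2), `ρ₂` (S4); `B = max b₀ b₁`, `ρ₀ = min (min ρ₁ ρ₂) (1/(16B³))`, `c' = zc/8`.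
For `ρ < ρ₀` and `N` large (S4's window `δ` at `ε = zc/4`; `L_N ≥ max(4B, B(L₀+4))`): `M = M_N` from
`latticeSize_select`; `A` at `(M, N)` gives `cNM³ ≤ bracket`; S3 gives a sector ground vector `ψ` with
`bracket ≤ cohSum ψ`; S2 gives `ofReal(zcN) ≤ ofReal(z·cohSum/M³) ≤ liminf_λ n₀⁺(λ,0)`; S1 gives
`n₀⁺(λ,0) ≤ n₀⁺(0,0)` eventually in `λ`, so `ofReal(zcN) ≤ n₀⁺(0,0)`; unfolding `n₀⁺(0,0)` at the window `δ` yields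
a `δ`-near-minimiser `Φ` with `n₀Φ > zcN/2`, and S4 transfers `n₀Ψ ≥ n₀Φ - zcN/4 ≥ zcN/8` to EVERY
`δ`-near-minimiser `Ψ`. -/
theorem LatticeToPeriodicBridge_of (h1a : Sig.stub_deepWallGerm) (h2' : Sig.stub_deepWellCondensateLimit)
    (hR : BECLiebAntibunching.PeriodicRigidity) : LatticeToPeriodicBridge := by
  -- the landed stubs (wave 1) and the landed route supports 9677/9678, by name
  have h1 : DeepWallsDeplete := deepWallsDeplete_of_germ stub_maxwellDanskin h1a
  have h2 : DeepWallBand := deepWallBand_of_deepWellCondensateLimit h2'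
  have h3 : LatticeReadout := stub_latticeReadout
  have h4 : FreeEndRigidity := stub_freeEndRigidity hR
  have hP : SectorGroundStatePerron := Theorems.SectorGroundStatePerron_proof
  have hQ : PenaltySelectsSector := Theorems.PenaltySelectsSector_proof
  intro hA v hv
  obtain ⟨c, hc, L₀, hlat⟩ := hA
  -- wall fraction ½
  have hw0 : (0 : ℝ) < 1 / 2 := by norm_num
  have hw1 : (1 / 2 : ℝ) < 1 := by norm_num
  obtain ⟨b₁, hb₁, ρ₁, hρ₁, hLDM⟩ := h1 v hv (1 / 2) hw0 hw1
  obtain ⟨b₀, hb₀, hBand⟩ := h2 v hv (1 / 2) hw0 hw1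
  obtain ⟨ρ₂, hρ₂, hRig⟩ := h4 v hv
  set z : ℝ := deepShare (1 / 2) with hz
  have hzpos : 0 < z := by
    rw [hz, deepShare, show (1 : ℝ) - 1 / 2 = 1 / 2 by norm_num]
    positivity
  set B : ℝ := max b₀ b₁ with hBdef
  have hBpos : 0 < B := lt_max_of_lt_left hb₀
  have hb₀B : b₀ ≤ B := le_max_left _ _
  have hb₁B : b₁ ≤ B := le_max_right _ _
  refine ⟨min (min ρ₁ ρ₂) (1 / (16 * B ^ 3)), lt_min (lt_min hρ₁ hρ₂) (by positivity), ?_⟩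
  intro ρ hρ hρlt
  have hρρ₁ : ρ < ρ₁ := hρlt.trans_le ((min_le_left _ _).trans (min_le_left _ _))
  have hρρ₂ : ρ < ρ₂ := hρlt.trans_le ((min_le_left _ _).trans (min_le_right _ _))
  have hρB : ρ ≤ 1 / (16 * B ^ 3) := (hρlt.trans_le (min_le_right _ _)).le
  have hzc : 0 < z * c := mul_pos hzpos hc
  refine ⟨z * c / 8, by positivity, ?_⟩
  -- eventually in N: the rigidity window (ε = zc/4), N ≥ 1, and L_N large
  have hev := hRig ρ hρ hρρ₂ (z * c / 4) (by positivity)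
  filter_upwards [hev, eventually_ge_atTop 1,
    (sideLength_tendsto hρ).eventually_ge_atTop (max (4 * B) (B * (L₀ + 4)))] with N hrigN hN1 hLN
  obtain ⟨δ, hδ, hrig⟩ := hrigN
  -- the lattice size
  obtain ⟨hMeven, hM2, hL₀M, hBM, h2N⟩ := latticeSize_select hBpos hρ hρB L₀ N hLN
  set L := sideLength ρ N with hLdef
  set M : ℕ := 2 * ⌊L / (2 * B)⌋₊ with hMdef
  refine ⟨δ, hδ, fun Ψ hΨ => ?_⟩
  haveI : NeZero M := ⟨by omega⟩
  have hNM : N ≤ M ^ 3 := (Nat.le_mul_of_pos_left N (by norm_num : 0 < 2)).trans h2N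
  have hM0 : (0 : ℝ) < M := by exact_mod_cast (show 0 < M by omega)
  -- the antecedent, consumed at (M, N): c N M³ ≤ bracket
  have hbr : c * N * (M : ℝ) ^ 3 ≤ latticeBracket M N := hlat M hL₀M hMeven N hN1 h2N
  -- S3: a normalised sector ground vector reading the bracket
  obtain ⟨ψ, hψ, hread⟩ := h3 hP hQ M hM2 N hN1 hNM
  -- S2: the deep-wall band
  have hb₀M : b₀ * M ≤ L := (mul_le_mul_of_nonneg_right hb₀B hM0.le).trans hBM
  have hband := hBand M hM2 L hb₀M N hN1 hNM ψ hψ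
  have hzcN : z * c * N ≤ z / (M : ℝ) ^ 3 * cohSum ψ N := by
    have hM3 : (0 : ℝ) < (M : ℝ) ^ 3 := by positivity
    rw [div_mul_eq_mul_div, le_div_iff₀ hM3]
    calc z * c * N * (M : ℝ) ^ 3 = z * (c * N * (M : ℝ) ^ 3) := by ring
      _ ≤ z * cohSum ψ N := mul_le_mul_of_nonneg_left (hbr.trans hread) hzpos.le
  have hkey : ENNReal.ofReal (z * c * N) ≤
      Filter.liminf (fun lam : ℝ => upperCondensate v N L M (1 / 2) lam 0) Filter.atTop :=
    (ENNReal.ofReal_le_ofReal hzcN).trans hband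
  -- S1 (deep LDM₀, eventually in λ): the liminf is below n₀⁺(0,0)
  have hb₁M : b₁ * M ≤ L := (mul_le_mul_of_nonneg_right hb₁B hM0.le).trans hBM
  have hNρ₁ : (N : ℝ) ≤ ρ₁ * L ^ 3 := by
    rw [hLdef, sideLength_cube hρ N]
    calc (N : ℝ) = ρ * (N / ρ) := by field_simp
      _ ≤ ρ₁ * (N / ρ) := mul_le_mul_of_nonneg_right hρρ₁.le (by positivity)
  have hldm : ∀ᶠ lam : ℝ in atTop,
      upperCondensate v N L M (1 / 2) lam 0 ≤ upperCondensate v N L M (1 / 2) 0 0 :=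
    hLDM M hM2 L hb₁M N hNρ₁
  have hlim : Filter.liminf (fun lam : ℝ => upperCondensate v N L M (1 / 2) lam 0) Filter.atTop ≤
      upperCondensate v N L M (1 / 2) 0 0 :=
    Filter.liminf_le_of_frequently_le' hldm.frequently
  have hU : ENNReal.ofReal (z * c * N) ≤ upperCondensate v N L M (1 / 2) 0 0 := hkey.trans hlim
  -- unfold n₀⁺(0,0) at S4's window δ: a δ-near-minimiser Φ with n₀ Φ > zcN/2
  have hNpos : 0 < N := hN1
  have hzcN0 : 0 < z * c * N := by positivity
  have hhalf : ENNReal.ofReal (z * c * N / 2) < upperCondensate v N L M (1 / 2) 0 0 := by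
    refine lt_of_lt_of_le ?_ hU
    rw [ENNReal.ofReal_lt_ofReal_iff hzcN0]
    linarith
  obtain ⟨Φ, hΦ, hΦocc⟩ := exists_nearMin_of_lt_upperCondensate hhalf hδ
  -- S4: every δ-near-minimiser Ψ inherits n₀ Ψ ≥ n₀ Φ - zcN/4 ≥ zcN/8
  have htrans := hrig Φ Ψ hΦ hΨ
  rw [show z * c / 4 * (N : ℝ) = z * c * N / 4 by ring] at htrans
  have h8 := eighth_le_of_half_lt hzcN0.le hΦocc htrans
  rwa [show z * c / 8 * (N : ℝ) = z * c * N / 8 by ring]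

/-- Wiring check: the two registered open stubs (and the route item 9467, as hypothesis by name) feed
`LatticeToPeriodicBridge_of` as stated. -/
example (hR : BECLiebAntibunching.PeriodicRigidity) : LatticeToPeriodicBridge :=
  LatticeToPeriodicBridge_of stub_deepWallGerm stub_deepWellCondensateLimit hR

end Summit.AtomisticToContinuum.BoseEinsteinCondensation.Cruxes.LatticeToPeriodicBridge.MuffinTinRewardSupermodularity

end
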